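import Summits.AtomisticToContinuum.FouriersLaw.Theses.CoercivePulse
import Summits.AtomisticToContinuum.FouriersLaw.Theorems.UnboundedHeatVariance.Negative.AbstractCage
import Summits.AtomisticToContinuum.FouriersLaw.Theorems.CoercivePulseLinearSpreadStubSpectralIncrements
import Summits.AtomisticToContinuum.FouriersLaw.Theorems.CoercivePulseLinearSpreadStubKaramataCollapse
import HarnessLib

/-!
# `LinearSpread` / Negative (3): the super-lacunary spectrum — infinitely-often diffusive spread with a
# diffusive ceiling but NO linear lower envelope

Support file (`--supports stmt-AtomisticToContinuum-15382`) of the crux disprover of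
`Summit.AtomisticToContinuum.FouriersLaw.Theses.CoercivePulse.LinearSpread`, written against the lead's picked line
`KaramataCollapse` (`Cruxes/LinearSpread/Lines/KaramataCollapse.lean`): modulo the landed analysis stubs K
(`stub_karamataCollapse`) and I (`stub_spectralIncrements`) and Helfand's identity, the line reduces the crux to
IO (`stub_infinitelyOftenSpread`: `m₀ t ≤ M(t)` infinitely often) + `LinearCeiling` + `AbelRegularity`.
QUESTION (joint sufficiency / which stub is load-bearing): can `AbelRegularity` be dropped — do IO and the ceiling,
together with everything structural about a heat variance (positive type: `V(τ) = 2∫₀^τ(τ-s)C(s)ds`, `C` the cosine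
transform of a finite measure; stationary-increment bound `|√V(t) - √V(s)| ≤ √V(t-s)`), already force the linear
lower envelope?  NO:

* the SUPER-LACUNARY spectral measure `ρ = Σₙ (4pₙ)⁻¹ δ_{1/pₙ}`, `pₙ = 2^(2ⁿ)` (so `p_{n+1} = pₙ²`), is finite and
  its heat variance is `V(τ) = Σₙ (pₙ/2)(1 - cos(τ/pₙ))` (`superlacunary_heatVariance_eq_tsum`);
* CEILING `V(τ) ≤ 4(1+τ)` (`superlacunary_heatVariance_le`): modes with `pₙ ≤ τ` give `≤ Σ pₙ ≤ 2 max pₙ ≤ 2τ+4`,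
  modes with `pₙ > τ` give `≤ τ² Σ (4pₙ)⁻¹ ≤ τ/2`;
* IO `V(π p_N) ≥ p_N` (`superlacunary_heatVariance_io`): the `N`-th mode alone, in antiphase;
* DIPS `V(2π p_N) ≤ 20` for EVERY `N` (`superlacunary_heatVariance_dip`): modes `n ≤ N` have completed
  `p_N/pₙ = 2^(2^N-2ⁿ) ∈ ℕ` periods, modes `n > N` give `≤ π² p_N² Σ_{n>N} 1/pₙ ≤ 2π²` since `p_N² = p_{N+1}`.

Consequences (landed in the companion file `LacunarySpreadEnvelope.lean`, which imports this one; this file = the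
measure, its heat variance in closed form and the three estimates):
* `not_linearEnvelope_of_io_and_ceiling` — the natural strengthening "finite spectral measure + linear ceiling +
  infinitely-often linear growth ⇒ eventual linear lower envelope" is FALSE; i.e. at the level of positive-type
  kernels, IO ∧ LinearCeiling ⇏ LinearSpread: the line's third physics input `AbelRegularity` is load-bearing, and
  a proof of the crux along this line must use zero-frequency NON-OSCILLATION of the current spectral measure;
* `stub_karamataCollapse_false_without_abel` — the registered stub K with its Abel-regularity hypothesis DELETED
  (everything else verbatim: `σ ≥ 0`, increments, `f = σ²`, ceiling, Laplace integrability, IO) is FALSE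
  (witness `f = V`, `σ = √V`, increments by the landed stub I);
* `superlacunary_abelMeans_oscillate` — read through the landed K, the Abel means `ν²∫₀^∞e^{-νt}V(t)dt`
  (`= 2∫ ν/(ν²+ω²)dρ`, twice the Poisson means of `ρ`) NEITHER converge NOR tend to `+∞` as `ν ↓ 0`: a second
  explicit oscillating-Poisson-means measure (cf. `Theorems/AbelRegularity/Negative/PoissonMeansOscillate.lean`,
  lacunary shells), this one with infinitely-often LINEAR heat-variance growth — the sharp enemy of the route:
  `LinearCeiling` true, IO true, `LinearSpread` false, `AbelRegularity` false.

Compared with `Theorems/UnboundedHeatVariance/Negative/LacunaryCage.lean` (`ρ = Σ 4⁻ⁿδ_{2⁻ⁿ}`, `V ≲ log τ`, no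
IO) the masses here scale like `ω` (not `ω²`) on a super-lacunary frequency set, which is what buys linear growth
infinitely often.  No new definitions (the measure is written out; lemmas take `hρ : ρ = …` as a hypothesis).
refuter-cdisprove-stmt-AtomisticToContinuum-15382-0, 2026-08-17.
-/

noncomputable section

namespace Summit.AtomisticToContinuum.FouriersLaw.Theorems.LinearSpread.Negative

open MeasureTheory Set Filter Topology
open scoped BigOperators
open Summit.AtomisticToContinuum.FouriersLaw.Theorems.UnboundedHeatVariance.Negative

/-! ## §0 Arithmetic of `pₙ = 2^(2ⁿ)` -/

/-- `p_{n+1} = pₙ²`. [folklore] -/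
theorem superlacunary_succ (n : ℕ) : (2:ℝ) ^ (2 ^ (n + 1)) = ((2:ℝ) ^ (2 ^ n)) ^ 2 := by
  rw [pow_succ, pow_mul]

/-- `2 ≤ pₙ`. [folklore] -/
theorem two_le_superlacunary (n : ℕ) : (2:ℝ) ≤ (2:ℝ) ^ (2 ^ n) := by
  calc (2:ℝ) = 2 ^ 1 := by norm_num
    _ ≤ 2 ^ (2 ^ n) := pow_le_pow_right₀ (by norm_num) Nat.one_le_two_pow

/-- `0 < pₙ`. [folklore] -/
theorem superlacunary_pos (n : ℕ) : (0:ℝ) < (2:ℝ) ^ (2 ^ n) := by positivity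

/-- `pₙ⁻¹ ≤ (1/2)^n` (since `2ⁿ ≥ n`). [folklore] -/
theorem inv_superlacunary_le (n : ℕ) : ((2:ℝ) ^ (2 ^ n))⁻¹ ≤ (1/2:ℝ) ^ n := by
  have h : (2:ℝ) ^ n ≤ (2:ℝ) ^ (2 ^ n) :=
    pow_le_pow_right₀ (by norm_num) Nat.lt_two_pow_self.le
  rw [one_div, inv_pow]
  exact inv_anti₀ (by positivity) h

/-- `n ≤ pₙ` (crude growth). [folklore] -/
theorem nat_le_superlacunary (n : ℕ) : (n:ℝ) ≤ (2:ℝ) ^ (2 ^ n) := by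
  have h1 : (n:ℝ) ≤ (2:ℝ) ^ n := by exact_mod_cast Nat.lt_two_pow_self.le
  exact h1.trans (pow_le_pow_right₀ (by norm_num) Nat.lt_two_pow_self.le)

/-- `p_{N+1} · 2^m ≤ p_{N+1+m}`. [folklore] -/
theorem superlacunary_tail_ge (N m : ℕ) :
    (2:ℝ) ^ (2 ^ (N + 1)) * (2:ℝ) ^ m ≤ (2:ℝ) ^ (2 ^ (N + 1 + m)) := by
  rw [← pow_add]
  refine pow_le_pow_right₀ (by norm_num) ?_
  have h1 : m + 1 ≤ 2 ^ m := Nat.lt_two_pow_self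
  have h2 : 1 ≤ 2 ^ (N + 1) := Nat.one_le_two_pow
  calc 2 ^ (N + 1) + m ≤ 2 ^ (N + 1) + 2 ^ (N + 1) * m := by nlinarith
    _ ≤ 2 ^ (N + 1) * 2 ^ m := by nlinarith
    _ = 2 ^ (N + 1 + m) := (pow_add 2 (N + 1) m).symm

/-- `Σ_{n ≤ N} pₙ ≤ 2 p_N`. [folklore] -/
theorem sum_superlacunary_le (N : ℕ) :
    ∑ n ∈ Finset.range (N + 1), (2:ℝ) ^ (2 ^ n) ≤ 2 * (2:ℝ) ^ (2 ^ N) := by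
  induction N with
  | zero => norm_num
  | succ N ih =>
    rw [Finset.sum_range_succ, superlacunary_succ]
    have h2 := two_le_superlacunary N
    nlinarith [ih, h2]

/-- Summability of the masses `(4pₙ)⁻¹` (and of anything dominated by `pₙ⁻¹`). [folklore] -/
theorem summable_inv_superlacunary : Summable fun n : ℕ => ((2:ℝ) ^ (2 ^ n))⁻¹ :=
  Summable.of_nonneg_of_le (fun n => by positivity) inv_superlacunary_le
    (summable_geometric_of_lt_one (by norm_num) (by norm_num))

/-! ## §1 The super-lacunary measure `ρ = Σₙ (4pₙ)⁻¹ δ_{pₙ⁻¹}` -/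

/-- Its total mass. [folklore] -/
theorem superlacunary_univ {ρ : Measure ℝ}
    (hρ : ρ = Measure.sum (fun n : ℕ =>
      ENNReal.ofReal (((2:ℝ) ^ (2 ^ n))⁻¹ / 4) • Measure.dirac (((2:ℝ) ^ (2 ^ n))⁻¹))) :
    ρ univ = ENNReal.ofReal (∑' n : ℕ, ((2:ℝ) ^ (2 ^ n))⁻¹ / 4) := by
  rw [hρ, Measure.sum_apply _ MeasurableSet.univ]
  simp only [Measure.smul_apply, measure_univ, smul_eq_mul, mul_one]
  rw [ENNReal.ofReal_tsum_of_nonneg (fun n => by positivity)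
    (summable_inv_superlacunary.div_const 4)]

/-- It is finite. [folklore] -/
theorem superlacunary_isFiniteMeasure {ρ : Measure ℝ}
    (hρ : ρ = Measure.sum (fun n : ℕ =>
      ENNReal.ofReal (((2:ℝ) ^ (2 ^ n))⁻¹ / 4) • Measure.dirac (((2:ℝ) ^ (2 ^ n))⁻¹))) :
    IsFiniteMeasure ρ :=
  ⟨by rw [superlacunary_univ hρ]; exact ENNReal.ofReal_lt_top⟩

/-- Integration against it: `∫ f dρ = Σₙ (4pₙ)⁻¹ f(pₙ⁻¹)` for bounded measurable `f`. [folklore] -/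
theorem integral_superlacunary {ρ : Measure ℝ}
    (hρ : ρ = Measure.sum (fun n : ℕ =>
      ENNReal.ofReal (((2:ℝ) ^ (2 ^ n))⁻¹ / 4) • Measure.dirac (((2:ℝ) ^ (2 ^ n))⁻¹)))
    {f : ℝ → ℝ} (hf : Measurable f) {B : ℝ} (hb : ∀ x, |f x| ≤ B) :
    ∫ w, f w ∂ρ = ∑' n : ℕ, ((2:ℝ) ^ (2 ^ n))⁻¹ / 4 * f (((2:ℝ) ^ (2 ^ n))⁻¹) := by
  haveI := superlacunary_isFiniteMeasure hρ
  have hint : Integrable f ρ :=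
    (integrable_const B).mono' hf.aestronglyMeasurable (Eventually.of_forall fun x => by
      simpa [Real.norm_eq_abs] using hb x)
  rw [hρ] at hint ⊢
  rw [integral_sum_measure hint]
  refine tsum_congr fun n => ?_
  rw [integral_smul_measure, integral_dirac, ENNReal.toReal_ofReal (by positivity), smul_eq_mul]

/-! ## §2 Its heat variance `V(τ) = Σₙ (pₙ/2)(1 - cos(τ/pₙ))` -/

/-- The kernel `C(s) = ∫cos(ωs)dρ = Σₙ (4pₙ)⁻¹ cos(s/pₙ)`. [folklore] -/
theorem superlacunary_kernel {ρ : Measure ℝ}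
    (hρ : ρ = Measure.sum (fun n : ℕ =>
      ENNReal.ofReal (((2:ℝ) ^ (2 ^ n))⁻¹ / 4) • Measure.dirac (((2:ℝ) ^ (2 ^ n))⁻¹))) (s : ℝ) :
    ∫ w, Real.cos (w * s) ∂ρ = ∑' n : ℕ, ((2:ℝ) ^ (2 ^ n))⁻¹ / 4 * Real.cos (((2:ℝ) ^ (2 ^ n))⁻¹ * s) :=
  integral_superlacunary hρ (by fun_prop) (B := 1) fun x => Real.abs_cos_le_one _

/-- The heat variance in closed form: `2∫_{(0,τ]}(τ-s)C(s)ds = Σₙ (pₙ/2)(1 - cos(τ/pₙ))`, `τ ≥ 0` (termwise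
integration; `2·(4p)⁻¹·(1-cos(τ/p))·p² = (p/2)(1-cos(τ/p))`). [folklore] -/
theorem superlacunary_heatVariance_eq_tsum {ρ : Measure ℝ}
    (hρ : ρ = Measure.sum (fun n : ℕ =>
      ENNReal.ofReal (((2:ℝ) ^ (2 ^ n))⁻¹ / 4) • Measure.dirac (((2:ℝ) ^ (2 ^ n))⁻¹))) {τ : ℝ} (hτ : 0 ≤ τ) :
    2 * ∫ s in Ioc (0:ℝ) τ, (τ - s) * ∫ w, Real.cos (w * s) ∂ρ
      = ∑' n : ℕ, (2:ℝ) ^ (2 ^ n) / 2 * (1 - Real.cos (((2:ℝ) ^ (2 ^ n))⁻¹ * τ)) := by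
  simp_rw [superlacunary_kernel hρ]
  have h1 : ∀ s : ℝ, (τ - s) * ∑' n : ℕ, ((2:ℝ) ^ (2 ^ n))⁻¹ / 4 * Real.cos (((2:ℝ) ^ (2 ^ n))⁻¹ * s)
      = ∑' n : ℕ, (τ - s) * (((2:ℝ) ^ (2 ^ n))⁻¹ / 4 * Real.cos (((2:ℝ) ^ (2 ^ n))⁻¹ * s)) := fun s => by
    rw [tsum_mul_left]
  simp_rw [h1]
  set F : ℕ → ℝ → ℝ := fun n s => (τ - s) * (((2:ℝ) ^ (2 ^ n))⁻¹ / 4 * Real.cos (((2:ℝ) ^ (2 ^ n))⁻¹ * s))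
    with hF
  have hFint : ∀ n, Integrable (F n) (volume.restrict (Ioc (0:ℝ) τ)) := fun n =>
    (by fun_prop : Continuous (F n)).integrableOn_Ioc
  have hbound : ∀ n, ∀ s ∈ Ioc (0:ℝ) τ, ‖F n s‖ ≤ τ * (((2:ℝ) ^ (2 ^ n))⁻¹ / 4) := by
    intro n s hs
    simp only [hF, norm_mul, Real.norm_eq_abs]
    have h1 : |τ - s| ≤ τ := by rw [abs_le]; constructor <;> linarith [hs.1, hs.2]
    have h2 : |((2:ℝ) ^ (2 ^ n))⁻¹ / 4| = ((2:ℝ) ^ (2 ^ n))⁻¹ / 4 := abs_of_nonneg (by positivity)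
    have h3 : |Real.cos (((2:ℝ) ^ (2 ^ n))⁻¹ * s)| ≤ 1 := Real.abs_cos_le_one _
    rw [h2]
    calc |τ - s| * (((2:ℝ) ^ (2 ^ n))⁻¹ / 4 * |Real.cos (((2:ℝ) ^ (2 ^ n))⁻¹ * s)|)
        ≤ τ * (((2:ℝ) ^ (2 ^ n))⁻¹ / 4 * 1) := by gcongr
      _ = τ * (((2:ℝ) ^ (2 ^ n))⁻¹ / 4) := by ring
  have hnorm : ∀ n, ∫ s in Ioc (0:ℝ) τ, ‖F n s‖ ≤ τ * (((2:ℝ) ^ (2 ^ n))⁻¹ / 4) * τ := by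
    intro n
    have := setIntegral_mono_on (hFint n).norm (integrableOn_const (by simp)) measurableSet_Ioc (hbound n)
    rw [setIntegral_const, Real.volume_real_Ioc_of_le hτ, sub_zero, smul_eq_mul] at this
    linarith [this]
  have hsum : Summable fun n => ∫ s in Ioc (0:ℝ) τ, ‖F n s‖ :=
    Summable.of_nonneg_of_le (fun n => integral_nonneg fun s => norm_nonneg _) hnorm
      (((summable_inv_superlacunary.div_const 4).mul_left τ).mul_right τ)
  rw [← integral_tsum_of_summable_integral_norm hFint hsum, ← tsum_mul_left]
  refine tsum_congr fun n => ?_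
  have hw : ((2:ℝ) ^ (2 ^ n))⁻¹ ≠ 0 := by positivity
  simp only [hF]
  rw [show (fun s => (τ - s) * (((2:ℝ) ^ (2 ^ n))⁻¹ / 4 * Real.cos (((2:ℝ) ^ (2 ^ n))⁻¹ * s)))
      = fun s => ((2:ℝ) ^ (2 ^ n))⁻¹ / 4 * ((τ - s) * Real.cos (((2:ℝ) ^ (2 ^ n))⁻¹ * s)) from
      funext fun s => by ring,
    integral_const_mul, integral_Ioc_sub_mul_cos hw hτ]
  have hp : (0:ℝ) < (2:ℝ) ^ (2 ^ n) := superlacunary_pos n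
  field_simp
  ring

/-- The terms are non-negative. [folklore] -/
theorem superlacunary_term_nonneg (n : ℕ) (τ : ℝ) :
    0 ≤ (2:ℝ) ^ (2 ^ n) / 2 * (1 - Real.cos (((2:ℝ) ^ (2 ^ n))⁻¹ * τ)) := by
  have := Real.cos_le_one (((2:ℝ) ^ (2 ^ n))⁻¹ * τ)
  have := superlacunary_pos n
  positivity

/-- The terms are `≤ pₙ`. [folklore] -/
theorem superlacunary_term_le_p (n : ℕ) (τ : ℝ) :
    (2:ℝ) ^ (2 ^ n) / 2 * (1 - Real.cos (((2:ℝ) ^ (2 ^ n))⁻¹ * τ)) ≤ (2:ℝ) ^ (2 ^ n) := by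
  have := Real.neg_one_le_cos (((2:ℝ) ^ (2 ^ n))⁻¹ * τ)
  have := superlacunary_pos n
  nlinarith

/-- The terms are `≤ τ²/(4pₙ)` (`1 - cos x ≤ x²/2`). [folklore] -/
theorem superlacunary_term_le_sq (n : ℕ) (τ : ℝ) :
    (2:ℝ) ^ (2 ^ n) / 2 * (1 - Real.cos (((2:ℝ) ^ (2 ^ n))⁻¹ * τ)) ≤ τ ^ 2 / 4 * ((2:ℝ) ^ (2 ^ n))⁻¹ := by
  have hc := Real.one_sub_sq_div_two_le_cos (x := ((2:ℝ) ^ (2 ^ n))⁻¹ * τ)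
  have hp := superlacunary_pos n
  have key : (2:ℝ) ^ (2 ^ n) / 2 * (1 - Real.cos (((2:ℝ) ^ (2 ^ n))⁻¹ * τ))
      ≤ (2:ℝ) ^ (2 ^ n) / 2 * ((((2:ℝ) ^ (2 ^ n))⁻¹ * τ) ^ 2 / 2) :=
    mul_le_mul_of_nonneg_left (by linarith) (by positivity)
  refine key.trans (le_of_eq ?_)
  field_simp
  ring

/-- Summability of the terms at every `τ`. [folklore] -/
theorem summable_superlacunary_term (τ : ℝ) :
    Summable fun n : ℕ => (2:ℝ) ^ (2 ^ n) / 2 * (1 - Real.cos (((2:ℝ) ^ (2 ^ n))⁻¹ * τ)) :=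
  Summable.of_nonneg_of_le (fun n => superlacunary_term_nonneg n τ) (fun n => superlacunary_term_le_sq n τ)
    (summable_inv_superlacunary.mul_left _)

/-! ## §3 The three estimates: ceiling, infinitely-often growth, dips -/

/-- **CEILING** `V(τ) ≤ 4(1+τ)` for `τ ≥ 0`. [folklore] -/
theorem superlacunary_tsum_le {τ : ℝ} (hτ : 0 ≤ τ) :
    ∑' n : ℕ, (2:ℝ) ^ (2 ^ n) / 2 * (1 - Real.cos (((2:ℝ) ^ (2 ^ n))⁻¹ * τ)) ≤ 4 * (1 + τ) := by
  classical
  -- the scale `N`: least `N` with `τ < p_{N+1}`; then `p_N ≤ τ + 2`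
  have hex : ∃ N : ℕ, τ < (2:ℝ) ^ (2 ^ (N + 1)) := by
    obtain ⟨N, hN⟩ := exists_nat_gt τ
    exact ⟨N, hN.trans_le ((nat_le_superlacunary N).trans
      (pow_le_pow_right₀ (by norm_num) (Nat.pow_le_pow_right two_pos (Nat.le_succ N))))⟩
  set N := Nat.find hex with hNdef
  have hN : τ < (2:ℝ) ^ (2 ^ (N + 1)) := Nat.find_spec hex
  have hPN : (2:ℝ) ^ (2 ^ N) ≤ τ + 2 := by
    rcases Nat.eq_zero_or_pos N with h0 | hpos
    · rw [h0]; norm_num; linarith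
    · obtain ⟨k, hk⟩ := Nat.exists_eq_succ_of_ne_zero hpos.ne'
      have hmin : ¬ τ < (2:ℝ) ^ (2 ^ (k + 1)) := Nat.find_min hex (by rw [← hNdef, hk]; exact Nat.lt_succ_self k)
      rw [hk]
      show (2:ℝ) ^ (2 ^ (k + 1)) ≤ τ + 2
      linarith [not_lt.1 hmin]
  set f : ℕ → ℝ := fun n => (2:ℝ) ^ (2 ^ n) / 2 * (1 - Real.cos (((2:ℝ) ^ (2 ^ n))⁻¹ * τ)) with hf
  have hs : Summable f := summable_superlacunary_term τ
  rw [← hs.sum_add_tsum_nat_add (N + 1)]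
  -- head
  have hhead : ∑ n ∈ Finset.range (N + 1), f n ≤ 2 * τ + 4 :=
    calc ∑ n ∈ Finset.range (N + 1), f n ≤ ∑ n ∈ Finset.range (N + 1), (2:ℝ) ^ (2 ^ n) :=
          Finset.sum_le_sum fun n _ => superlacunary_term_le_p n τ
      _ ≤ 2 * (2:ℝ) ^ (2 ^ N) := sum_superlacunary_le N
      _ ≤ 2 * τ + 4 := by linarith
  -- tail
  have hPN1 : (0:ℝ) < (2:ℝ) ^ (2 ^ (N + 1)) := superlacunary_pos _
  have htail_term : ∀ m : ℕ, f (m + (N + 1)) ≤ τ ^ 2 / 4 * ((2:ℝ) ^ (2 ^ (N + 1)))⁻¹ * (1/2:ℝ) ^ m := by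
    intro m
    refine (superlacunary_term_le_sq _ τ).trans ?_
    have hge := superlacunary_tail_ge N m
    rw [show m + (N + 1) = N + 1 + m by ring]
    have h2m : (0:ℝ) < (2:ℝ) ^ m := by positivity
    rw [mul_assoc]
    refine mul_le_mul_of_nonneg_left ?_ (by positivity)
    rw [one_div, inv_pow, ← mul_inv]
    exact inv_anti₀ (by positivity) hge
  have hgeo : Summable fun m : ℕ => τ ^ 2 / 4 * ((2:ℝ) ^ (2 ^ (N + 1)))⁻¹ * (1/2:ℝ) ^ m :=
    (summable_geometric_of_lt_one (by norm_num) (by norm_num)).mul_left _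
  have hstail : Summable fun m : ℕ => f (m + (N + 1)) := (summable_nat_add_iff (N + 1)).2 hs
  have htail : ∑' m : ℕ, f (m + (N + 1)) ≤ τ / 2 :=
    calc ∑' m : ℕ, f (m + (N + 1)) ≤ ∑' m : ℕ, τ ^ 2 / 4 * ((2:ℝ) ^ (2 ^ (N + 1)))⁻¹ * (1/2:ℝ) ^ m :=
          hstail.tsum_le_tsum htail_term hgeo
      _ = τ ^ 2 / 4 * ((2:ℝ) ^ (2 ^ (N + 1)))⁻¹ * (1 - 1/2)⁻¹ := by
          rw [tsum_mul_left, tsum_geometric_of_lt_one (by norm_num) (by norm_num)]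
      _ = τ * (τ / (2:ℝ) ^ (2 ^ (N + 1))) / 2 := by field_simp; ring
      _ ≤ τ * 1 / 2 := by
          gcongr
          exact (div_le_one hPN1).2 hN.le
      _ = τ / 2 := by ring
  linarith

/-- **INFINITELY-OFTEN GROWTH** `p_N ≤ V(π p_N)` (the `N`-th mode in antiphase). [folklore] -/
theorem le_superlacunary_tsum_antiphase (N : ℕ) :
    (2:ℝ) ^ (2 ^ N) ≤ ∑' n : ℕ, (2:ℝ) ^ (2 ^ n) / 2 *
      (1 - Real.cos (((2:ℝ) ^ (2 ^ n))⁻¹ * (Real.pi * (2:ℝ) ^ (2 ^ N)))) := by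
  have hs := summable_superlacunary_term (Real.pi * (2:ℝ) ^ (2 ^ N))
  have hN : (2:ℝ) ^ (2 ^ N) / 2 * (1 - Real.cos (((2:ℝ) ^ (2 ^ N))⁻¹ * (Real.pi * (2:ℝ) ^ (2 ^ N))))
      = (2:ℝ) ^ (2 ^ N) := by
    have hp : (2:ℝ) ^ (2 ^ N) ≠ 0 := (superlacunary_pos N).ne'
    rw [show ((2:ℝ) ^ (2 ^ N))⁻¹ * (Real.pi * (2:ℝ) ^ (2 ^ N)) = Real.pi by field_simp, Real.cos_pi]
    ring
  calc (2:ℝ) ^ (2 ^ N) = ∑ n ∈ ({N} : Finset ℕ), (2:ℝ) ^ (2 ^ n) / 2 *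
        (1 - Real.cos (((2:ℝ) ^ (2 ^ n))⁻¹ * (Real.pi * (2:ℝ) ^ (2 ^ N)))) := by
        rw [Finset.sum_singleton, hN]
    _ ≤ _ := hs.sum_le_tsum _ fun n _ => superlacunary_term_nonneg n _

/-- **DIPS** `V(2π p_N) ≤ 20` for every `N` (modes `n ≤ N` in phase, tail `≤ 2π²`). [folklore] -/
theorem superlacunary_tsum_inphase_le (N : ℕ) :
    ∑' n : ℕ, (2:ℝ) ^ (2 ^ n) / 2 *
      (1 - Real.cos (((2:ℝ) ^ (2 ^ n))⁻¹ * (2 * Real.pi * (2:ℝ) ^ (2 ^ N)))) ≤ 20 := by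
  set τ : ℝ := 2 * Real.pi * (2:ℝ) ^ (2 ^ N) with hτdef
  set f : ℕ → ℝ := fun n => (2:ℝ) ^ (2 ^ n) / 2 * (1 - Real.cos (((2:ℝ) ^ (2 ^ n))⁻¹ * τ)) with hf
  have hs : Summable f := summable_superlacunary_term τ
  -- head terms vanish: `τ/pₙ = (p_N/pₙ)·2π` with `p_N/pₙ = 2^(2^N-2ⁿ) ∈ ℕ`
  have hhead : ∀ n ∈ Finset.range (N + 1), f n = 0 := by
    intro n hn
    have hn' : n ≤ N := Nat.lt_succ_iff.1 (Finset.mem_range.1 hn)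
    have hpow : 2 ^ n ≤ 2 ^ N := Nat.pow_le_pow_right two_pos hn'
    have harg : ((2:ℝ) ^ (2 ^ n))⁻¹ * τ = ((2 ^ (2 ^ N - 2 ^ n) : ℕ) : ℝ) * (2 * Real.pi) := by
      rw [hτdef]
      push_cast
      have hp : (2:ℝ) ^ (2 ^ n) ≠ 0 := (superlacunary_pos n).ne'
      rw [← Nat.sub_add_cancel hpow, pow_add, Nat.add_sub_cancel]
      field_simp
    simp only [hf]
    rw [harg, Real.cos_nat_mul_two_pi]
    ring
  -- tail terms
  have hPN1 : (0:ℝ) < (2:ℝ) ^ (2 ^ (N + 1)) := superlacunary_pos _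
  have htail_term : ∀ m : ℕ, f (m + (N + 1)) ≤ Real.pi ^ 2 * (1/2:ℝ) ^ m := by
    intro m
    refine (superlacunary_term_le_sq _ τ).trans ?_
    have hge := superlacunary_tail_ge N m
    rw [show m + (N + 1) = N + 1 + m by ring]
    have hsq : τ ^ 2 / 4 = Real.pi ^ 2 * (2:ℝ) ^ (2 ^ (N + 1)) := by
      rw [hτdef, superlacunary_succ]; ring
    rw [hsq, mul_assoc]
    refine mul_le_mul_of_nonneg_left ?_ (by positivity)
    rw [one_div, inv_pow]
    have h2m : (0:ℝ) < (2:ℝ) ^ m := by positivity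
    calc (2:ℝ) ^ (2 ^ (N + 1)) * ((2:ℝ) ^ (2 ^ (N + 1 + m)))⁻¹
        ≤ (2:ℝ) ^ (2 ^ (N + 1)) * ((2:ℝ) ^ (2 ^ (N + 1)) * (2:ℝ) ^ m)⁻¹ := by
          gcongr
      _ = ((2:ℝ) ^ m)⁻¹ := by field_simp
  have hgeo : Summable fun m : ℕ => Real.pi ^ 2 * (1/2:ℝ) ^ m :=
    (summable_geometric_of_lt_one (by norm_num) (by norm_num)).mul_left _
  have hstail : Summable fun m : ℕ => f (m + (N + 1)) := (summable_nat_add_iff (N + 1)).2 hs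
  rw [← hs.sum_add_tsum_nat_add (N + 1), Finset.sum_eq_zero hhead, zero_add]
  calc ∑' m : ℕ, f (m + (N + 1)) ≤ ∑' m : ℕ, Real.pi ^ 2 * (1/2:ℝ) ^ m := hstail.tsum_le_tsum htail_term hgeo
    _ = Real.pi ^ 2 * (1 - 1/2)⁻¹ := by
        rw [tsum_mul_left, tsum_geometric_of_lt_one (by norm_num) (by norm_num)]
    _ ≤ 20 := by nlinarith [Real.pi_lt_d2, Real.pi_pos]

end Summit.AtomisticToContinuum.FouriersLaw.Theorems.LinearSpread.Negative

end
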